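import Summits.QuantumFields.BalabanUV.T4Continuum.Support.NE7HintOfSliceNormalisationGeneric
import Summits.QuantumFields.BalabanUV.T4Continuum.Support.NE7HdecompOfNL0Generic
import Summits.QuantumFields.BalabanUV.T4Continuum.Support.NE7EnergyRateWGeneric
import HarnessLib

/-!
# NE7HintUnconditionalGeneric — PORT MAP P2, FILE 6: (8)∃ WITH NO DISPLAYED HYPOTHESIS FOR EVERY UNITARY GAUGE GROUP `U(n)` AND EVERY BLOCK SIZE `L ≥ 2`, `d = 4` —
# `NE7HintUnconditionalSU2.hint_SU2_unconditional ∕ hint_SU2_small_data` (gen 104, `card n = 2`, `L = 2`) RE-ISSUED GENERICALLY: P2.5 `hint_of_decomposition_generic` ((8)∃ ⇐ ONE k-free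
# strict line ∧ `hdecomp♭`) with `hdecomp♭` DISCHARGED by P2.6a `hdecomp_of_nl0_generic` and the strict line DISCHARGED for `ε ≤ ε₀(L, card n)` by gen 105's `line_of_small_card`
# (the three ceilings are LINEAR in `ε`)

Cell `pub-balaban`, rung (B)+1 sub-cell t4, lineage `b2b-balaban-t4-ne7-p1`, generation 109 (CRUX PROVER NE7 #1 = OWNER of BINDER row NE7).  Memo
`t4/b2b-balaban-t4-ne7-p1-g109/ROAD-G109.md` §3 (PORT MAP item P2.6 — THE END OF P2: [Balaban1985Variational] Thm 1 (8) TYPE for OUR constrained Wilson minimisers, every `U(n)`, every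
`L ≥ 2`, finite T⁴, small data).
WHAT ([folklore]; 0 def, 0 sorry).  **`hint_unconditional_generic`**: for every `L ≥ 2` there are `ℓ ≥ 1`, `ε₀ > 0` and, for every `0 < ε ≤ ε₀`, a `β₀ > 0` such that for `0 < β ≤ β₀` and every
period `N ≥ 1` there is `δ_V > 0` with: for every unitary `N`-periodic `V` with `SmallField V δ_V` and every level `k`, SOME constrained Wilson minimiser over `sfClass 4 L N ε` at level `k`
over the datum `V` is `SmallField U a` with `0 ≤ a < ε·(L^k)^{−2}`; **`hint_small_data_generic`**: the consumer shape (`β := β₀(ε)`).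
HONEST FRAMING (page 1): a composition of landed kernel theorems of this lineage (gens 84–109), of row NE3's∕NE7b's support files, and of [B7]∕[B8]∕[B11] AS TYPED in the tree; nothing of
Bałaban's is asserted as an axiom and no hypothesis is displayed; constants existential (depending on `L`, `card n`).  WHAT IT IS: (8)∃ for every `U(n)`, every `L ≥ 2`, `d = 4`, finite T⁴ —
the `hint` INPUT of the NE7 route-1 ENDs, whose (n, L)-generic re-issue is PORT MAP P3; WHAT IT IS NOT: NE7 as a spine node, NOT infinite volume, NOT mass gap, NOT BetaPertH, NOT Clay (continuum
YM on T⁴ ⇐ BetaPertH ∧ nine spine estimates).  Axioms ⊆ {propext, Classical.choice, Quot.sound}; 0 sorry.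
-/

set_option autoImplicit false

open scoped BigOperators Matrix Matrix.Norms.L2Operator Topology
open NormedSpace Finset Set Filter

namespace Summit.QuantumFields.BalabanUV.T4Continuum.NE7HintUnconditionalGeneric

open Literature.MathematicalPhysics.QuantumFieldTheory.Balaban1983to89
open B7Prop1Explicit B7Prop2Explicit MatrixLog
open T4AveragingDeficitWall (IsUnitaryCfg IsSkewDir SmallField)
open T4AveragingDeficitWallBoundary (IsPeriodicCfg)
open MinimalActionSandwich (IsMinimiser)
open MinimalActionRate (sfClass)
open NE7HintOfSliceNormalisationGeneric (hint_of_decomposition_generic)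
open NE7HdecompOfNL0Generic (hdecomp_of_nl0_generic)
open NE7EnergyRateWGeneric (line_of_small_card)

noncomputable section

variable {n : Type} [Fintype n] [DecidableEq n]

/-- **(8)∃ FOR EVERY `U(n)` AND EVERY BLOCK SIZE `L ≥ 2`, `d = 4`, NO DISPLAYED HYPOTHESIS** (statement in the file header). [folklore] -/
theorem hint_unconditional_generic [Nonempty n] {L : ℕ} (hL : 2 ≤ L) :
    ∃ ℓ : ℕ, 1 ≤ ℓ ∧ ∃ ε₀ : ℝ, 0 < ε₀ ∧ ∀ ε : ℝ, 0 < ε → ε ≤ ε₀ → ∃ β₀ : ℝ, 0 < β₀ ∧ ∀ β : ℝ, 0 < β → β ≤ β₀ →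
    ∀ (N : ℕ) [NeZero N], 1 ≤ N →
    ∃ δV : ℝ, 0 < δV ∧
      ∀ V ∈ {V : Site 4 → Fin 4 → (Matrix n n ℂ)ˣ | IsUnitaryCfg V ∧ IsPeriodicCfg V (N : ℤ) ∧ SmallField V δV},
      ∀ k : ℕ, ∃ U : Site 4 → Fin 4 → (Matrix n n ℂ)ˣ, IsMinimiser 4 (sfClass 4 L N ε) L N k V U ∧
        ∃ a : ℝ, 0 ≤ a ∧ a < ε / ((L : ℝ) ^ k) ^ 2 ∧ SmallField U a := by
  obtain ⟨CE, hCE, ℓ, hℓ1, ε₀, hε₀, H⟩ := hint_of_decomposition_generic (n := n) hL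
  obtain ⟨ε₂, hε₂, CS, hCS, νc, hνc, κc, hκc, hdec⟩ := hdecomp_of_nl0_generic (n := n) hL
  -- the strict line's constants
  obtain ⟨Q, hQ⟩ : ∃ Q : ℝ, Q = 2 * (1 + CE) := ⟨_, rfl⟩
  have hQ0 : 0 < Q := by rw [hQ]; linarith
  -- the k-free line is closed at `Q′ = max Q 4 ≥ 4` and transported to `Q ≤ Q′` by monotonicity (`1∕2 − ν̂² ≥ 0`)
  set Q' : ℝ := max Q 4 with hQ'
  have hQ4 : 4 ≤ Q' := le_max_right _ _
  have hQQ' : Q ≤ Q' := le_max_left _ _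
  have hcard1 : (1 : ℝ) ≤ (Fintype.card n : ℝ) := by exact_mod_cast Fintype.card_pos
  obtain ⟨c, hc⟩ : ∃ c : ℝ, c = 2 * κc + νc ^ 2 + 2304 * (CS ^ 2 * Real.exp (2 * CS)) + 112 * (1 + 7 * CS ^ 2) + 1 := ⟨_, rfl⟩
  have hc0 : 0 < c := by rw [hc]; positivity
  have hνc_le : νc ^ 2 ≤ c := by rw [hc]; nlinarith [hκc, Real.exp_pos (2 * CS), sq_nonneg CS]
  obtain ⟨ε₃, hε₃⟩ : ∃ ε₃ : ℝ, ε₃ = (1 / 2) / Q' / 4 / (Fintype.card n : ℝ) / c := ⟨_, rfl⟩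
  have hε₃0 : 0 < ε₃ := by rw [hε₃]; positivity
  refine ⟨ℓ, hℓ1, min ε₀ (min ε₂ (min 1 ε₃)), lt_min hε₀ (lt_min hε₂ (lt_min one_pos hε₃0)), fun ε hε hεle => ?_⟩
  have hεε₀ : ε ≤ ε₀ := hεle.trans (min_le_left _ _)
  have hεε₂ : ε ≤ ε₂ := hεle.trans ((min_le_right _ _).trans (min_le_left _ _))
  have hε1 : ε ≤ 1 := hεle.trans ((min_le_right _ _).trans ((min_le_right _ _).trans (min_le_left _ _)))
  have hεε₃ : ε ≤ ε₃ := hεle.trans ((min_le_right _ _).trans ((min_le_right _ _).trans (min_le_right _ _)))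
  have hsmall : c * ε ≤ (1 / 2) / Q' / 4 / (Fintype.card n : ℝ) := by
    have h1 : c * ε ≤ c * ε₃ := mul_le_mul_of_nonneg_left hεε₃ hc0.le
    have h2 : c * ε₃ = (1 / 2) / Q' / 4 / (Fintype.card n : ℝ) := by rw [hε₃]; field_simp
    linarith only [h1, h2]
  obtain ⟨β₀, hβ₀, H2⟩ := H ε hε hεε₀
  refine ⟨β₀, hβ₀, fun β hβ hβle N _ hN => ?_⟩
  have hline' := line_of_small_card (c := (Fintype.card n : ℝ)) hQ4 hcard1 hCS hε hε1 (by rw [← hc]; exact hsmall)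
  -- transport from `Q′` to `Q`
  have hν2 : (νc * ε) ^ 2 ≤ 1 / 2 := by
    have h1 : νc ^ 2 * ε ≤ c * ε := mul_le_mul_of_nonneg_right hνc_le hε.le
    have h2 : (1 / 2) / Q' / 4 / (Fintype.card n : ℝ) ≤ 1 / 2 := by
      have hQ'0 : 0 < Q' := by linarith
      have hcard0 : (0 : ℝ) < Fintype.card n := by linarith
      rw [div_le_iff₀ hcard0, div_le_iff₀ (by norm_num : (0:ℝ) < 4), div_le_iff₀ hQ'0]
      nlinarith
    have h3 : (νc * ε) ^ 2 = νc ^ 2 * ε * ε := by ring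
    rw [h3]
    have h4 : νc ^ 2 * ε ≤ 1 / 2 := by linarith
    nlinarith [sq_nonneg νc, hε.le]
  have hmono : (1 / 2 - (νc * ε) ^ 2) / Q' ≤ (1 / 2 - (νc * ε) ^ 2) / Q :=
    div_le_div_of_nonneg_left (by linarith) hQ0 hQQ'
  have hline : 2 * (κc * ε) < ((((1 / 2 - (νc * ε) ^ 2) / (2 * (1 + CE)) - (νc * ε) ^ 2) / 2
      - 576 * ((4 : ℕ) : ℝ) * ((CS * ε) ^ 2 * Real.exp (2 * (CS * ε)))) / (Fintype.card n : ℝ) - 28 * ((4 : ℕ) : ℝ) * (ε + 7 * (CS * ε) ^ 2)) := by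
    rw [← hQ]
    have hcard0 : (0 : ℝ) ≤ Fintype.card n := by positivity
    have hstep : (((1 / 2 - (νc * ε) ^ 2) / Q' - (νc * ε) ^ 2) / 2 - 576 * ((4 : ℕ) : ℝ) * ((CS * ε) ^ 2 * Real.exp (2 * (CS * ε)))) / (Fintype.card n : ℝ)
        ≤ (((1 / 2 - (νc * ε) ^ 2) / Q - (νc * ε) ^ 2) / 2 - 576 * ((4 : ℕ) : ℝ) * ((CS * ε) ^ 2 * Real.exp (2 * (CS * ε)))) / (Fintype.card n : ℝ) :=
      div_le_div_of_nonneg_right (by linarith) hcard0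
    linarith
  refine H2 β hβ hβle N (CS * ε) (νc * ε) (κc * ε) hN hline ?_
  intro D hD hDP hDS k Us hUs hUsS hcrit U' hU' u₀ hu₀ hu₀P hpin hclose
  exact hdec N ε hε hεε₂ β D hD hDP hDS k Us hUs hUsS hcrit U' hU' u₀ hu₀ hu₀P hpin hclose

/-- **(8)∃ FOR EVERY `U(n)` AND EVERY `L ≥ 2`, THE CONSUMER SHAPE** (the vestigial `ℓ` and the coupling parameter `β` eliminated — `β := β₀(ε)`): `∃ ε₀ > 0, ∀ 0 < ε ≤ ε₀, ∀ N ≥ 1, ∃ δ_V > 0`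
such that the `hint` binder of the route-1 ENDs holds on the small data `{V | unitary, N-periodic, SmallField V δ_V}` at block size `L`. [folklore] -/
theorem hint_small_data_generic [Nonempty n] {L : ℕ} (hL : 2 ≤ L) :
    ∃ ε₀ : ℝ, 0 < ε₀ ∧ ∀ ε : ℝ, 0 < ε → ε ≤ ε₀ → ∀ (N : ℕ) [NeZero N], 1 ≤ N →
    ∃ δV : ℝ, 0 < δV ∧
      ∀ V ∈ {V : Site 4 → Fin 4 → (Matrix n n ℂ)ˣ | IsUnitaryCfg V ∧ IsPeriodicCfg V (N : ℤ) ∧ SmallField V δV},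
      ∀ k : ℕ, ∃ U : Site 4 → Fin 4 → (Matrix n n ℂ)ˣ, IsMinimiser 4 (sfClass 4 L N ε) L N k V U ∧
        ∃ a : ℝ, 0 ≤ a ∧ a < ε / ((L : ℝ) ^ k) ^ 2 ∧ SmallField U a := by
  obtain ⟨-, -, ε₀, hε₀, H⟩ := hint_unconditional_generic (n := n) hL
  refine ⟨ε₀, hε₀, fun ε hε hεle N _ hN => ?_⟩
  obtain ⟨β₀, hβ₀, H2⟩ := H ε hε hεle
  exact H2 β₀ hβ₀ le_rfl N hN

end

end Summit.QuantumFields.BalabanUV.T4Continuum.NE7HintUnconditionalGeneric
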